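import Literature.NumberTheory.Sieve.BombieriFriedlanderIwaniecDispersion
import Mathlib.NumberTheory.DirichletCharacter.Orthogonality
import Mathlib.Analysis.Fourier.FourierTransform
import HarnessLib

/-!
# Bombieri–Friedlander–Iwaniec 1986, §9: the sum `𝓑` of (9.14) and Cauchy's inequality with multiplicity

Topic `Literature/NumberTheory/Sieve`.  Second file of the formalisation of the provable part of
§9 of E. Bombieri, J. B. Friedlander, H. Iwaniec, *Primes in arithmetic progressions to large
moduli*, Acta Math. 156 (1986), 203–251 (toward **Theorem 2**, the named fact
`Literature.NumberTheory.Sieve.BombieriFriedlanderIwaniecTheorem2` of `…Dispersion`).  It defines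
the trilinear sum `𝓑_β(C, D, K, H, N)` of (9.14), p. 230, to which §9 reduces `ℛ₁` and which BFI's
Lemma 7 bounds (from Lemma 1 = Deshouillers–Iwaniec), and proves the step (9.12) ⇒ (9.13): Cauchy's
inequality with the multiplicity of the representation `c = n₁ q₂`.  Everything here is PROVED; no
named facts are introduced.

## Contents

* `BFI.rho n = ∑_{αβ=n} (α, β)` (the function `ϱ` of Lemma 7), `BFI.rho_eq_card_divisors`
  (`ϱ = τ` on squarefree `n`, BFI's Remark p. 231), `BFI.one_le_rho`.
* `BFI.klNum a c nd = a·(nd)‾ mod c` (the reduced numerator of the Kloosterman fraction),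
  `BFI.bInner` (the inner sum `∑_{h ≤ H} ∑_{n ≤ N, (nd,c)=1} β(h,n) χ(n) e(ahk(nd)‾/c)`), and
  **`BFI.dispBm a m C D K H N β`** — `𝓑` of (9.14) with the character average over `χ (mod mk)`
  for a fixed multiplier `m ≥ 1` (`m = 1` is the printed `𝓑`); `BFI.dispBm_nonneg`,
  `BFI.dispBm_eq_sum_k` (the `k`-sum outermost).
* `BFI.card_dirichletCharacter`,
  `BFI.sum_sum_comp_mul_le` (summing `g(n₁q₂)` with multiplicity), and
  **`BFI.sum_weighted_norm_le`**:
  `∑_k φ(mk)⁻¹ ∑_χ ∑_{q₁,q₂,n₁} |A₁(q₁)A₂(q₂)b(n₁)| ‖S_{k,χ}(n₁q₂, q₁)‖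
    ≤ (#𝒦 ∑A₁² ∑A₂² ∑b²)^{1/2} (μ ∑_k φ(mk)⁻¹ ∑_χ ∑_{c≤C} ∑_{d≤D} ‖S_{k,χ}(c,d)‖²)^{1/2}`,
  `μ` = the maximal multiplicity of `c = n₁q₂` — the passage from (9.12) to (9.13) in which the
  right-hand factor is `𝓑` (when `S = bInner`).

## Why `χ (mod mk)` (faithfulness to §9)

On p. 228 BFI detect the conditions (9.4), `n₁ ≡ n₂ (mod δq₀k)` and `(δq₀k, n₁n₂) = 1`, by
characters `χ (mod k)` and `ψ (mod δq₀)` separately ((9.7)); this is only correct when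
`(k, δq₀) = 1`.  Detecting the congruence by the characters modulo `δq₀k` instead leads to `𝓑` with
the average `φ(mk)⁻¹ ∑_{χ (mod mk)}`, `m = δq₀`, and the Kloosterman phase unchanged (it involves
`k`, not `mk`); the proof of Lemma 7 from Lemma 1 on pp. 230–231 goes through verbatim for this
sum (the diagonal and the coefficients `B_{lr}` are sub-sums of those for `m = 1`), uniformly in
`m`.  The files `…DispersionR1Second*` therefore reduce `ℛ₁` to `dispBm` with `m = δq₀`, and the
hypothesis standing in for Lemma 7 is stated for `dispBm`.

## References

* E. Bombieri, J. B. Friedlander, H. Iwaniec, Acta Math. 156 (1986), 203–251, §9 (9.12)–(9.14)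
  and Lemma 7, pp. 229–231. [BombieriFriedlanderIwaniecActa1986]
-/

noncomputable section

open Finset Real
open scoped ArithmeticFunction.sigma FourierTransform

namespace Literature.NumberTheory.Sieve

namespace BFI

/-! ### `ϱ(n) = ∑_{αβ = n} (α, β)` -/

/-- `ϱ(n) = ∑_{αβ = n} gcd(α, β)` (BFI p. 230, Lemma 7). [cite: BombieriFriedlanderIwaniecActa1986, §9 Lemma 7 p. 230] -/
def rho (n : ℕ) : ℕ := ∑ d ∈ n.divisors, Nat.gcd d (n / d)

/-- For squarefree `n`, `ϱ(n) = τ(n)` (BFI p. 231, Remark: "In the circumstances of `ℛ₁` the `n`'s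
are squarefree, so `ϱ(n) = τ(n)`"). [cite: BombieriFriedlanderIwaniecActa1986, §9 p. 231] -/
theorem rho_eq_card_divisors {n : ℕ} (hn : Squarefree n) : rho n = n.divisors.card := by
  unfold rho
  rw [Finset.card_eq_sum_ones]
  refine Finset.sum_congr rfl fun d hd => ?_
  have hd0 : 0 < d := Nat.pos_of_mem_divisors hd
  obtain ⟨e, rfl⟩ := Nat.dvd_of_mem_divisors hd
  rw [Nat.mul_div_cancel_left e hd0]
  exact (Nat.squarefree_mul_iff.1 hn).1

/-- `ϱ(n) ≥ 0`-trivia: `1 ≤ ϱ(n)` for `n ≠ 0`. [folklore] -/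
theorem one_le_rho {n : ℕ} (hn : n ≠ 0) : 1 ≤ rho n := by
  unfold rho
  have h1 : 1 ∈ n.divisors := Nat.one_mem_divisors.2 hn
  calc 1 = Nat.gcd 1 (n / 1) := by simp
    _ ≤ ∑ d ∈ n.divisors, Nat.gcd d (n / d) :=
        Finset.single_le_sum (f := fun d => Nat.gcd d (n / d)) (fun _ _ => Nat.zero_le _) h1

/-! ### The Kloosterman phase and the sum `𝓑` -/

/-- The reduced numerator `a · (nd)‾ (mod c)` of the Kloosterman fraction `a (nd)‾/c`, as a
natural number `< c` (and `0` if `(nd, c) > 1` or `c = 0`). [folklore] -/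
def klNum (a : ℤ) (c nd : ℕ) : ℕ := ((a : ZMod c) * ((nd : ℕ) : ZMod c)⁻¹).val

/-- The inner sum of `𝓑`: `∑_{h ≤ H} ∑_{n ≤ N, (nd, c) = 1} β(h, n) χ(n) e(a h k (nd)‾ / c)` for a
character `χ (mod mk)`. [cite: BombieriFriedlanderIwaniecActa1986, §9 (9.14) p. 230] -/
def bInner (a : ℤ) (m : ℕ) (H N : ℝ) (β : ℕ → ℕ → ℂ) (c d k : ℕ)
    (χ : DirichletCharacter ℂ (m * k)) : ℂ :=
  ∑ h ∈ Icc 1 ⌊H⌋₊, ∑ n ∈ (Icc 1 ⌊N⌋₊).filter (fun n => c.Coprime (n * d)),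
    β h n * χ (n : ZMod (m * k)) * (𝐞 ((klNum a c (n * d) : ℝ) * h * k / c) : ℂ)

/-- **BFI's sum `𝓑_β(C, D, K, H, N)`** of (9.14), p. 230, with the character group enlarged from
`(mod k)` to `(mod mk)` for a fixed multiplier `m ≥ 1` (`m = 1` is the printed sum):
`𝓑 = ∑_{c ≤ C} ∑_{d ≤ D} ∑_{k ≤ K} φ(mk)⁻¹ ∑_{χ (mod mk)} |∑_{h ≤ H} ∑_{n ≤ N} β(h,n) χ(n) e(ahk (nd)‾/c)|²`
(terms with `(nd, c) > 1` absent). [cite: BombieriFriedlanderIwaniecActa1986, §9 (9.14) p. 230] -/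
def dispBm (a : ℤ) (m : ℕ) (C D K H N : ℝ) (β : ℕ → ℕ → ℂ) : ℝ :=
  ∑ c ∈ Icc 1 ⌊C⌋₊, ∑ d ∈ Icc 1 ⌊D⌋₊, ∑ k ∈ Icc 1 ⌊K⌋₊,
    ((Nat.totient (m * k) : ℝ))⁻¹ * ∑ χ : DirichletCharacter ℂ (m * k), ‖bInner a m H N β c d k χ‖ ^ 2

/-- `𝓑 ≥ 0`. [folklore] -/
theorem dispBm_nonneg (a : ℤ) (m : ℕ) (C D K H N : ℝ) (β : ℕ → ℕ → ℂ) :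
    0 ≤ dispBm a m C D K H N β :=
  Finset.sum_nonneg fun _ _ => Finset.sum_nonneg fun _ _ => Finset.sum_nonneg fun _ _ =>
    mul_nonneg (inv_nonneg.2 (Nat.cast_nonneg _)) (Finset.sum_nonneg fun _ _ => by positivity)

/-- `𝓑` with the `k`-sum outermost. [folklore] -/
theorem dispBm_eq_sum_k (a : ℤ) (m : ℕ) (C D K H N : ℝ) (β : ℕ → ℕ → ℂ) :
    dispBm a m C D K H N β = ∑ k ∈ Icc 1 ⌊K⌋₊, ((Nat.totient (m * k) : ℝ))⁻¹ *
      ∑ χ : DirichletCharacter ℂ (m * k), ∑ c ∈ Icc 1 ⌊C⌋₊, ∑ d ∈ Icc 1 ⌊D⌋₊,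
        ‖bInner a m H N β c d k χ‖ ^ 2 := by
  unfold dispBm
  -- bring `k` outside
  rw [Finset.sum_congr rfl fun c _ => Finset.sum_comm, Finset.sum_comm]
  refine Finset.sum_congr rfl fun k _ => ?_
  -- `∑_c ∑_d φ⁻¹ ∑_χ G = φ⁻¹ ∑_χ ∑_c ∑_d G`
  set φi : ℝ := ((Nat.totient (m * k) : ℝ))⁻¹
  set G : ℕ → ℕ → DirichletCharacter ℂ (m * k) → ℝ := fun c d χ => ‖bInner a m H N β c d k χ‖ ^ 2
    with hG
  calc ∑ c ∈ Icc 1 ⌊C⌋₊, ∑ d ∈ Icc 1 ⌊D⌋₊, φi * ∑ χ : DirichletCharacter ℂ (m * k), G c d χ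
      = ∑ c ∈ Icc 1 ⌊C⌋₊, ∑ d ∈ Icc 1 ⌊D⌋₊, ∑ χ : DirichletCharacter ℂ (m * k), φi * G c d χ := by
        simp_rw [Finset.mul_sum]
    _ = ∑ c ∈ Icc 1 ⌊C⌋₊, ∑ χ : DirichletCharacter ℂ (m * k), ∑ d ∈ Icc 1 ⌊D⌋₊, φi * G c d χ := by
        refine Finset.sum_congr rfl fun c _ => ?_
        exact Finset.sum_comm
    _ = ∑ χ : DirichletCharacter ℂ (m * k), ∑ c ∈ Icc 1 ⌊C⌋₊, ∑ d ∈ Icc 1 ⌊D⌋₊, φi * G c d χ :=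
        Finset.sum_comm
    _ = φi * ∑ χ : DirichletCharacter ℂ (m * k), ∑ c ∈ Icc 1 ⌊C⌋₊, ∑ d ∈ Icc 1 ⌊D⌋₊, G c d χ := by
        simp_rw [Finset.mul_sum]


/-! ### Cauchy's inequality with the multiplicity of `c = n₁ q₂` (BFI p. 229, (9.12) ⇒ (9.13)) -/

/-- The number of Dirichlet characters modulo `n` is `φ(n)`. [folklore] -/
theorem card_dirichletCharacter (n : ℕ) [NeZero n] :
    (Finset.univ : Finset (DirichletCharacter ℂ n)).card = Nat.totient n := by
  rw [Finset.card_univ, ← Nat.card_eq_fintype_card]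
  exact DirichletCharacter.card_eq_totient_of_hasEnoughRootsOfUnity ℂ n

/-- **Summing a nonnegative function of `c = n₁ q₂` with multiplicity**: if every product
`n₁ q₂` (`q₂ ∈ S₂`, `n₁ ∈ 𝒩`) lies in `[1, C]` and each value is taken at most `μ` times, then
`∑_{q₂, n₁} g(n₁ q₂) ≤ μ ∑_{c ≤ C} g(c)` for `g ≥ 0`. [folklore] -/
theorem sum_sum_comp_mul_le {S₂ 𝒩 : Finset ℕ} {Cn mult : ℕ} {g : ℕ → ℝ} (hg : ∀ c, 0 ≤ g c)
    (hC : ∀ q₂ ∈ S₂, ∀ n₁ ∈ 𝒩, n₁ * q₂ ∈ Icc 1 Cn)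
    (hmult : ∀ c, ((S₂ ×ˢ 𝒩).filter (fun p : ℕ × ℕ => p.2 * p.1 = c)).card ≤ mult) :
    ∑ q₂ ∈ S₂, ∑ n₁ ∈ 𝒩, g (n₁ * q₂) ≤ mult * ∑ c ∈ Icc 1 Cn, g c := by
  classical
  rw [← Finset.sum_product (s := S₂) (t := 𝒩) (f := fun p : ℕ × ℕ => g (p.2 * p.1))]
  rw [Finset.sum_comp g fun p : ℕ × ℕ => p.2 * p.1]
  calc ∑ c ∈ (S₂ ×ˢ 𝒩).image (fun p : ℕ × ℕ => p.2 * p.1),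
        ((S₂ ×ˢ 𝒩).filter (fun p : ℕ × ℕ => p.2 * p.1 = c)).card • g c
      ≤ ∑ c ∈ (S₂ ×ˢ 𝒩).image (fun p : ℕ × ℕ => p.2 * p.1), (mult : ℝ) * g c := by
        refine Finset.sum_le_sum fun c _ => ?_
        rw [nsmul_eq_mul]
        exact mul_le_mul_of_nonneg_right (by exact_mod_cast hmult c) (hg c)
    _ ≤ ∑ c ∈ Icc 1 Cn, (mult : ℝ) * g c := by
        refine Finset.sum_le_sum_of_subset_of_nonneg ?_ fun c _ _ => by
          exact mul_nonneg (Nat.cast_nonneg _) (hg c)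
        intro c hc
        rw [Finset.mem_image] at hc
        obtain ⟨p, hp, rfl⟩ := hc
        rw [Finset.mem_product] at hp
        exact hC p.1 hp.1 p.2 hp.2
    _ = mult * ∑ c ∈ Icc 1 Cn, g c := by rw [Finset.mul_sum]

/-- **Cauchy's inequality with multiplicity** (BFI p. 229, the step (9.12) ⇒ (9.13)): for each
`k ∈ 𝒦`, characters `χ (mod mk)`, and the outer variables `q₁ ∈ S₁ ⊆ [1, D]`, `q₂ ∈ S₂`,
`n₁ ∈ 𝒩` with `c = n₁ q₂ ∈ [1, C]` taken with multiplicity `≤ μ`,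
`∑_k φ(mk)⁻¹ ∑_χ ∑_{q₁,q₂,n₁} |A₁(q₁) A₂(q₂) b(n₁)| ‖S_{k,χ}(n₁q₂, q₁)‖
  ≤ (#𝒦 ∑A₁² ∑A₂² ∑b²)^{1/2} (μ ∑_k φ(mk)⁻¹ ∑_χ ∑_{c ≤ C} ∑_{d ≤ D} ‖S_{k,χ}(c,d)‖²)^{1/2}`.
[cite: BombieriFriedlanderIwaniecActa1986, §9 (9.12)–(9.14) pp. 229–230] -/
theorem sum_weighted_norm_le {m : ℕ} (hm : 0 < m) (𝒦 S₁ S₂ 𝒩 : Finset ℕ) (h𝒦 : ∀ k ∈ 𝒦, 0 < k)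
    (A₁ A₂ b : ℕ → ℝ) (S : (k : ℕ) → DirichletCharacter ℂ (m * k) → ℕ → ℕ → ℂ) {Cn Dn mult : ℕ}
    (hS₁ : S₁ ⊆ Icc 1 Dn) (hC : ∀ q₂ ∈ S₂, ∀ n₁ ∈ 𝒩, n₁ * q₂ ∈ Icc 1 Cn)
    (hmult : ∀ c, ((S₂ ×ˢ 𝒩).filter (fun p : ℕ × ℕ => p.2 * p.1 = c)).card ≤ mult) :
    ∑ k ∈ 𝒦, ((Nat.totient (m * k) : ℝ))⁻¹ * ∑ χ : DirichletCharacter ℂ (m * k),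
        ∑ q₁ ∈ S₁, ∑ q₂ ∈ S₂, ∑ n₁ ∈ 𝒩, |A₁ q₁| * |A₂ q₂| * |b n₁| * ‖S k χ (n₁ * q₂) q₁‖ ≤
      Real.sqrt (𝒦.card * ((∑ q₁ ∈ S₁, A₁ q₁ ^ 2) * (∑ q₂ ∈ S₂, A₂ q₂ ^ 2) *
          ∑ n₁ ∈ 𝒩, b n₁ ^ 2)) *
        Real.sqrt (mult * ∑ k ∈ 𝒦, ((Nat.totient (m * k) : ℝ))⁻¹ *
          ∑ χ : DirichletCharacter ℂ (m * k), ∑ c ∈ Icc 1 Cn, ∑ d ∈ Icc 1 Dn, ‖S k χ c d‖ ^ 2) := by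
  classical
  set P : ℝ := (∑ q₁ ∈ S₁, A₁ q₁ ^ 2) * (∑ q₂ ∈ S₂, A₂ q₂ ^ 2) * ∑ n₁ ∈ 𝒩, b n₁ ^ 2 with hP
  have hA1 : 0 ≤ ∑ q₁ ∈ S₁, A₁ q₁ ^ 2 := Finset.sum_nonneg fun _ _ => sq_nonneg _
  have hA2 : 0 ≤ ∑ q₂ ∈ S₂, A₂ q₂ ^ 2 := Finset.sum_nonneg fun _ _ => sq_nonneg _
  have hb : 0 ≤ ∑ n₁ ∈ 𝒩, b n₁ ^ 2 := Finset.sum_nonneg fun _ _ => sq_nonneg _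
  have hP0 : 0 ≤ P := by positivity
  -- the quantity `U_k = φ(mk)⁻¹ ∑_χ ∑_{q₁,q₂,n₁} ‖S(n₁q₂,q₁)‖²` and its majorant
  set U : ℕ → ℝ := fun k => ((Nat.totient (m * k) : ℝ))⁻¹ *
    ∑ χ : DirichletCharacter ℂ (m * k), ∑ q₁ ∈ S₁, ∑ q₂ ∈ S₂, ∑ n₁ ∈ 𝒩,
      ‖S k χ (n₁ * q₂) q₁‖ ^ 2 with hU
  set W : ℕ → ℝ := fun k => ((Nat.totient (m * k) : ℝ))⁻¹ *
    ∑ χ : DirichletCharacter ℂ (m * k), ∑ c ∈ Icc 1 Cn, ∑ d ∈ Icc 1 Dn, ‖S k χ c d‖ ^ 2 with hW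
  have hU0 : ∀ k, 0 ≤ U k := fun k => mul_nonneg (inv_nonneg.2 (Nat.cast_nonneg _))
    (Finset.sum_nonneg fun _ _ => Finset.sum_nonneg fun _ _ => Finset.sum_nonneg fun _ _ =>
      Finset.sum_nonneg fun _ _ => sq_nonneg _)
  have hUW : ∀ k, U k ≤ mult * W k := by
    intro k
    simp only [hU, hW]
    rw [mul_left_comm]
    refine mul_le_mul_of_nonneg_left ?_ (inv_nonneg.2 (Nat.cast_nonneg _))
    rw [Finset.mul_sum]
    refine Finset.sum_le_sum fun χ _ => ?_
    -- `∑_{q₁} ∑_{q₂,n₁} g ≤ ∑_{q₁} mult ∑_c g ≤ mult ∑_c ∑_d`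
    calc ∑ q₁ ∈ S₁, ∑ q₂ ∈ S₂, ∑ n₁ ∈ 𝒩, ‖S k χ (n₁ * q₂) q₁‖ ^ 2
        ≤ ∑ q₁ ∈ S₁, (mult : ℝ) * ∑ c ∈ Icc 1 Cn, ‖S k χ c q₁‖ ^ 2 :=
          Finset.sum_le_sum fun q₁ _ =>
            sum_sum_comp_mul_le (g := fun c => ‖S k χ c q₁‖ ^ 2) (fun _ => sq_nonneg _) hC hmult
      _ ≤ ∑ d ∈ Icc 1 Dn, (mult : ℝ) * ∑ c ∈ Icc 1 Cn, ‖S k χ c d‖ ^ 2 :=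
          Finset.sum_le_sum_of_subset_of_nonneg hS₁ fun d _ _ =>
            mul_nonneg (Nat.cast_nonneg _) (Finset.sum_nonneg fun _ _ => sq_nonneg _)
      _ = (mult : ℝ) * ∑ c ∈ Icc 1 Cn, ∑ d ∈ Icc 1 Dn, ‖S k χ c d‖ ^ 2 := by
          rw [← Finset.mul_sum, Finset.sum_comm]
  -- per `k`: `T_k ≤ √P √(U k)`
  have hk : ∀ k ∈ 𝒦, ((Nat.totient (m * k) : ℝ))⁻¹ * ∑ χ : DirichletCharacter ℂ (m * k),
      ∑ q₁ ∈ S₁, ∑ q₂ ∈ S₂, ∑ n₁ ∈ 𝒩, |A₁ q₁| * |A₂ q₂| * |b n₁| * ‖S k χ (n₁ * q₂) q₁‖ ≤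
      Real.sqrt P * Real.sqrt (U k) := by
    intro k hk𝒦
    have hmk : 0 < m * k := Nat.mul_pos hm (h𝒦 k hk𝒦)
    haveI : NeZero (m * k) := ⟨hmk.ne'⟩
    have hφ : (0 : ℝ) < (Nat.totient (m * k) : ℝ) := by exact_mod_cast Nat.totient_pos.2 hmk
    -- innermost: over `n₁`
    have h1 : ∀ (χ : DirichletCharacter ℂ (m * k)) (q₁ q₂ : ℕ),
        ∑ n₁ ∈ 𝒩, |A₁ q₁| * |A₂ q₂| * |b n₁| * ‖S k χ (n₁ * q₂) q₁‖ ≤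
          |A₁ q₁| * |A₂ q₂| * (Real.sqrt (∑ n₁ ∈ 𝒩, b n₁ ^ 2) *
            Real.sqrt (∑ n₁ ∈ 𝒩, ‖S k χ (n₁ * q₂) q₁‖ ^ 2)) := by
      intro χ q₁ q₂
      have := Real.sum_mul_le_sqrt_mul_sqrt 𝒩 (fun n₁ => |b n₁|) (fun n₁ => ‖S k χ (n₁ * q₂) q₁‖)
      simp only [sq_abs] at this
      calc ∑ n₁ ∈ 𝒩, |A₁ q₁| * |A₂ q₂| * |b n₁| * ‖S k χ (n₁ * q₂) q₁‖
          = |A₁ q₁| * |A₂ q₂| * ∑ n₁ ∈ 𝒩, |b n₁| * ‖S k χ (n₁ * q₂) q₁‖ := by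
            rw [Finset.mul_sum]; refine Finset.sum_congr rfl fun _ _ => ?_; ring
        _ ≤ _ := mul_le_mul_of_nonneg_left this (by positivity)
    -- over `q₂`
    have h2 : ∀ (χ : DirichletCharacter ℂ (m * k)) (q₁ : ℕ),
        ∑ q₂ ∈ S₂, ∑ n₁ ∈ 𝒩, |A₁ q₁| * |A₂ q₂| * |b n₁| * ‖S k χ (n₁ * q₂) q₁‖ ≤
          |A₁ q₁| * Real.sqrt (∑ n₁ ∈ 𝒩, b n₁ ^ 2) * (Real.sqrt (∑ q₂ ∈ S₂, A₂ q₂ ^ 2) *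
            Real.sqrt (∑ q₂ ∈ S₂, ∑ n₁ ∈ 𝒩, ‖S k χ (n₁ * q₂) q₁‖ ^ 2)) := by
      intro χ q₁
      have hcs := Real.sum_mul_le_sqrt_mul_sqrt S₂ (fun q₂ => |A₂ q₂|)
        (fun q₂ => Real.sqrt (∑ n₁ ∈ 𝒩, ‖S k χ (n₁ * q₂) q₁‖ ^ 2))
      simp only [sq_abs] at hcs
      have hsq : ∀ q₂, Real.sqrt (∑ n₁ ∈ 𝒩, ‖S k χ (n₁ * q₂) q₁‖ ^ 2) ^ 2 =
          ∑ n₁ ∈ 𝒩, ‖S k χ (n₁ * q₂) q₁‖ ^ 2 := fun q₂ =>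
        Real.sq_sqrt (Finset.sum_nonneg fun _ _ => sq_nonneg _)
      simp only [hsq] at hcs
      calc ∑ q₂ ∈ S₂, ∑ n₁ ∈ 𝒩, |A₁ q₁| * |A₂ q₂| * |b n₁| * ‖S k χ (n₁ * q₂) q₁‖
          ≤ ∑ q₂ ∈ S₂, |A₁ q₁| * |A₂ q₂| * (Real.sqrt (∑ n₁ ∈ 𝒩, b n₁ ^ 2) *
              Real.sqrt (∑ n₁ ∈ 𝒩, ‖S k χ (n₁ * q₂) q₁‖ ^ 2)) :=
            Finset.sum_le_sum fun q₂ _ => h1 χ q₁ q₂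
        _ = |A₁ q₁| * Real.sqrt (∑ n₁ ∈ 𝒩, b n₁ ^ 2) * ∑ q₂ ∈ S₂, |A₂ q₂| *
              Real.sqrt (∑ n₁ ∈ 𝒩, ‖S k χ (n₁ * q₂) q₁‖ ^ 2) := by
            rw [Finset.mul_sum]; refine Finset.sum_congr rfl fun _ _ => ?_; ring
        _ ≤ _ := mul_le_mul_of_nonneg_left hcs (by positivity)
    -- over `q₁`
    have h3 : ∀ (χ : DirichletCharacter ℂ (m * k)),
        ∑ q₁ ∈ S₁, ∑ q₂ ∈ S₂, ∑ n₁ ∈ 𝒩, |A₁ q₁| * |A₂ q₂| * |b n₁| * ‖S k χ (n₁ * q₂) q₁‖ ≤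
          Real.sqrt (∑ n₁ ∈ 𝒩, b n₁ ^ 2) * Real.sqrt (∑ q₂ ∈ S₂, A₂ q₂ ^ 2) *
            (Real.sqrt (∑ q₁ ∈ S₁, A₁ q₁ ^ 2) *
              Real.sqrt (∑ q₁ ∈ S₁, ∑ q₂ ∈ S₂, ∑ n₁ ∈ 𝒩, ‖S k χ (n₁ * q₂) q₁‖ ^ 2)) := by
      intro χ
      have hcs := Real.sum_mul_le_sqrt_mul_sqrt S₁ (fun q₁ => |A₁ q₁|)
        (fun q₁ => Real.sqrt (∑ q₂ ∈ S₂, ∑ n₁ ∈ 𝒩, ‖S k χ (n₁ * q₂) q₁‖ ^ 2))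
      simp only [sq_abs] at hcs
      have hsq : ∀ q₁, Real.sqrt (∑ q₂ ∈ S₂, ∑ n₁ ∈ 𝒩, ‖S k χ (n₁ * q₂) q₁‖ ^ 2) ^ 2 =
          ∑ q₂ ∈ S₂, ∑ n₁ ∈ 𝒩, ‖S k χ (n₁ * q₂) q₁‖ ^ 2 := fun q₁ =>
        Real.sq_sqrt (Finset.sum_nonneg fun _ _ => Finset.sum_nonneg fun _ _ => sq_nonneg _)
      simp only [hsq] at hcs
      calc ∑ q₁ ∈ S₁, ∑ q₂ ∈ S₂, ∑ n₁ ∈ 𝒩, |A₁ q₁| * |A₂ q₂| * |b n₁| * ‖S k χ (n₁ * q₂) q₁‖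
          ≤ ∑ q₁ ∈ S₁, |A₁ q₁| * Real.sqrt (∑ n₁ ∈ 𝒩, b n₁ ^ 2) *
              (Real.sqrt (∑ q₂ ∈ S₂, A₂ q₂ ^ 2) *
                Real.sqrt (∑ q₂ ∈ S₂, ∑ n₁ ∈ 𝒩, ‖S k χ (n₁ * q₂) q₁‖ ^ 2)) :=
            Finset.sum_le_sum fun q₁ _ => h2 χ q₁
        _ = Real.sqrt (∑ n₁ ∈ 𝒩, b n₁ ^ 2) * Real.sqrt (∑ q₂ ∈ S₂, A₂ q₂ ^ 2) *
              ∑ q₁ ∈ S₁, |A₁ q₁| *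
                Real.sqrt (∑ q₂ ∈ S₂, ∑ n₁ ∈ 𝒩, ‖S k χ (n₁ * q₂) q₁‖ ^ 2) := by
            rw [Finset.mul_sum]; refine Finset.sum_congr rfl fun _ _ => ?_; ring
        _ ≤ _ := mul_le_mul_of_nonneg_left hcs (by positivity)
    -- over `χ`
    have hcsχ := Real.sum_mul_le_sqrt_mul_sqrt (Finset.univ : Finset (DirichletCharacter ℂ (m * k)))
      (fun _ => (1 : ℝ))
      (fun χ => Real.sqrt (∑ q₁ ∈ S₁, ∑ q₂ ∈ S₂, ∑ n₁ ∈ 𝒩, ‖S k χ (n₁ * q₂) q₁‖ ^ 2))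
    have hsqχ : ∀ χ : DirichletCharacter ℂ (m * k),
        Real.sqrt (∑ q₁ ∈ S₁, ∑ q₂ ∈ S₂, ∑ n₁ ∈ 𝒩, ‖S k χ (n₁ * q₂) q₁‖ ^ 2) ^ 2 =
          ∑ q₁ ∈ S₁, ∑ q₂ ∈ S₂, ∑ n₁ ∈ 𝒩, ‖S k χ (n₁ * q₂) q₁‖ ^ 2 := fun χ =>
      Real.sq_sqrt (Finset.sum_nonneg fun _ _ => Finset.sum_nonneg fun _ _ =>
        Finset.sum_nonneg fun _ _ => sq_nonneg _)
    simp only [one_pow, Finset.sum_const, nsmul_eq_mul, mul_one, one_mul, hsqχ,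
      card_dirichletCharacter] at hcsχ
    -- assemble
    have hsum : ∑ χ : DirichletCharacter ℂ (m * k), ∑ q₁ ∈ S₁, ∑ q₂ ∈ S₂, ∑ n₁ ∈ 𝒩,
        |A₁ q₁| * |A₂ q₂| * |b n₁| * ‖S k χ (n₁ * q₂) q₁‖ ≤
        Real.sqrt (∑ n₁ ∈ 𝒩, b n₁ ^ 2) * Real.sqrt (∑ q₂ ∈ S₂, A₂ q₂ ^ 2) *
          Real.sqrt (∑ q₁ ∈ S₁, A₁ q₁ ^ 2) * (Real.sqrt (Nat.totient (m * k)) *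
            Real.sqrt (∑ χ : DirichletCharacter ℂ (m * k), ∑ q₁ ∈ S₁, ∑ q₂ ∈ S₂, ∑ n₁ ∈ 𝒩,
              ‖S k χ (n₁ * q₂) q₁‖ ^ 2)) := by
      calc ∑ χ : DirichletCharacter ℂ (m * k), ∑ q₁ ∈ S₁, ∑ q₂ ∈ S₂, ∑ n₁ ∈ 𝒩,
            |A₁ q₁| * |A₂ q₂| * |b n₁| * ‖S k χ (n₁ * q₂) q₁‖
          ≤ ∑ χ : DirichletCharacter ℂ (m * k), Real.sqrt (∑ n₁ ∈ 𝒩, b n₁ ^ 2) *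
              Real.sqrt (∑ q₂ ∈ S₂, A₂ q₂ ^ 2) * (Real.sqrt (∑ q₁ ∈ S₁, A₁ q₁ ^ 2) *
                Real.sqrt (∑ q₁ ∈ S₁, ∑ q₂ ∈ S₂, ∑ n₁ ∈ 𝒩, ‖S k χ (n₁ * q₂) q₁‖ ^ 2)) :=
            Finset.sum_le_sum fun χ _ => h3 χ
        _ = Real.sqrt (∑ n₁ ∈ 𝒩, b n₁ ^ 2) * Real.sqrt (∑ q₂ ∈ S₂, A₂ q₂ ^ 2) *
              Real.sqrt (∑ q₁ ∈ S₁, A₁ q₁ ^ 2) * ∑ χ : DirichletCharacter ℂ (m * k),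
                Real.sqrt (∑ q₁ ∈ S₁, ∑ q₂ ∈ S₂, ∑ n₁ ∈ 𝒩, ‖S k χ (n₁ * q₂) q₁‖ ^ 2) := by
            rw [Finset.mul_sum]; refine Finset.sum_congr rfl fun _ _ => ?_; ring
        _ ≤ _ := mul_le_mul_of_nonneg_left hcsχ (by positivity)
    -- multiply by `φ⁻¹`
    have hφU : Real.sqrt (U k) = (Real.sqrt (Nat.totient (m * k)))⁻¹ *
        Real.sqrt (∑ χ : DirichletCharacter ℂ (m * k), ∑ q₁ ∈ S₁, ∑ q₂ ∈ S₂, ∑ n₁ ∈ 𝒩,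
          ‖S k χ (n₁ * q₂) q₁‖ ^ 2) := by
      simp only [hU]
      rw [Real.sqrt_mul (inv_nonneg.2 hφ.le), Real.sqrt_inv]
    have hPs : Real.sqrt P = Real.sqrt (∑ q₁ ∈ S₁, A₁ q₁ ^ 2) *
        Real.sqrt (∑ q₂ ∈ S₂, A₂ q₂ ^ 2) * Real.sqrt (∑ n₁ ∈ 𝒩, b n₁ ^ 2) := by
      rw [hP, Real.sqrt_mul (mul_nonneg hA1 hA2), Real.sqrt_mul hA1]
    rw [hφU, hPs]
    have hsφ : 0 < Real.sqrt (Nat.totient (m * k)) := Real.sqrt_pos.2 hφ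
    calc ((Nat.totient (m * k) : ℝ))⁻¹ * ∑ χ : DirichletCharacter ℂ (m * k), ∑ q₁ ∈ S₁,
          ∑ q₂ ∈ S₂, ∑ n₁ ∈ 𝒩, |A₁ q₁| * |A₂ q₂| * |b n₁| * ‖S k χ (n₁ * q₂) q₁‖
        ≤ ((Nat.totient (m * k) : ℝ))⁻¹ * (Real.sqrt (∑ n₁ ∈ 𝒩, b n₁ ^ 2) *
            Real.sqrt (∑ q₂ ∈ S₂, A₂ q₂ ^ 2) * Real.sqrt (∑ q₁ ∈ S₁, A₁ q₁ ^ 2) *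
            (Real.sqrt (Nat.totient (m * k)) *
              Real.sqrt (∑ χ : DirichletCharacter ℂ (m * k), ∑ q₁ ∈ S₁, ∑ q₂ ∈ S₂, ∑ n₁ ∈ 𝒩,
                ‖S k χ (n₁ * q₂) q₁‖ ^ 2))) :=
          mul_le_mul_of_nonneg_left hsum (inv_nonneg.2 hφ.le)
      _ = _ := by
          have key : ((Nat.totient (m * k) : ℝ))⁻¹ * Real.sqrt (Nat.totient (m * k)) =
              (Real.sqrt (Nat.totient (m * k)))⁻¹ := by
            have hs2 : Real.sqrt (Nat.totient (m * k)) * Real.sqrt (Nat.totient (m * k)) =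
                (Nat.totient (m * k) : ℝ) := Real.mul_self_sqrt hφ.le
            field_simp
            linarith [hs2]
          rw [show ((Nat.totient (m * k) : ℝ))⁻¹ * (Real.sqrt (∑ n₁ ∈ 𝒩, b n₁ ^ 2) *
              Real.sqrt (∑ q₂ ∈ S₂, A₂ q₂ ^ 2) * Real.sqrt (∑ q₁ ∈ S₁, A₁ q₁ ^ 2) *
              (Real.sqrt (Nat.totient (m * k)) *
                Real.sqrt (∑ χ : DirichletCharacter ℂ (m * k), ∑ q₁ ∈ S₁, ∑ q₂ ∈ S₂,
                  ∑ n₁ ∈ 𝒩, ‖S k χ (n₁ * q₂) q₁‖ ^ 2))) =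
              (((Nat.totient (m * k) : ℝ))⁻¹ * Real.sqrt (Nat.totient (m * k))) *
              (Real.sqrt (∑ n₁ ∈ 𝒩, b n₁ ^ 2) *
                Real.sqrt (∑ q₂ ∈ S₂, A₂ q₂ ^ 2) * Real.sqrt (∑ q₁ ∈ S₁, A₁ q₁ ^ 2) *
                Real.sqrt (∑ χ : DirichletCharacter ℂ (m * k), ∑ q₁ ∈ S₁, ∑ q₂ ∈ S₂,
                  ∑ n₁ ∈ 𝒩, ‖S k χ (n₁ * q₂) q₁‖ ^ 2)) by ring, key]
          ring
  -- sum over `k` and the last Cauchy–Schwarz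
  calc ∑ k ∈ 𝒦, ((Nat.totient (m * k) : ℝ))⁻¹ * ∑ χ : DirichletCharacter ℂ (m * k),
        ∑ q₁ ∈ S₁, ∑ q₂ ∈ S₂, ∑ n₁ ∈ 𝒩, |A₁ q₁| * |A₂ q₂| * |b n₁| * ‖S k χ (n₁ * q₂) q₁‖
      ≤ ∑ k ∈ 𝒦, Real.sqrt P * Real.sqrt (U k) := Finset.sum_le_sum hk
    _ = Real.sqrt P * ∑ k ∈ 𝒦, 1 * Real.sqrt (U k) := by rw [Finset.mul_sum]; simp
    _ ≤ Real.sqrt P * (Real.sqrt (∑ k ∈ 𝒦, (1 : ℝ) ^ 2) * Real.sqrt (∑ k ∈ 𝒦, Real.sqrt (U k) ^ 2)) :=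
        mul_le_mul_of_nonneg_left (Real.sum_mul_le_sqrt_mul_sqrt 𝒦 _ _) (Real.sqrt_nonneg _)
    _ = Real.sqrt (𝒦.card * P) * Real.sqrt (∑ k ∈ 𝒦, U k) := by
        simp only [one_pow, Finset.sum_const, nsmul_eq_mul, mul_one]
        rw [Finset.sum_congr rfl fun k _ => Real.sq_sqrt (hU0 k), Real.sqrt_mul (Nat.cast_nonneg _)]
        ring
    _ ≤ Real.sqrt (𝒦.card * P) * Real.sqrt (mult * ∑ k ∈ 𝒦, W k) := by
        gcongr
        rw [Finset.mul_sum]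
        exact Finset.sum_le_sum fun k _ => hUW k

end BFI

end Literature.NumberTheory.Sieve
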